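import Literature.Claims.NS.Magsanop2026
import Literature.Analysis.FluidPDE.ClassicalSolutionRescale
import Literature.Analysis.FluidPDE.ClayClassLerayHopfUniqueness
import Literature.Analysis.FluidPDE.NormalisedPressureDuality
import Literature.Analysis.FluidPDE.NSLerayHopfSereginEnergyProofs
import Literature.Barriers.NavierStokesRegularity.SmallDataGlobalRegularity
import Summits.NavierStokesRegularity.NavierStokesRegularity.Theorems.SoloRefuteRamm2024
import Summits.NavierStokesRegularity.NavierStokesRegularity.Theorems.SoloRefuteNguyen2022Field
import Mathlib.MeasureTheory.Measure.Haar.NormedSpace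
import HarnessLib

/-!
# C145 `Magsanop2026` — kernel refutation of Theorem 2 («V1 Main Result», the energy-decay rate)

Cell `ns-claims` (D-0090), claim skeleton `Literature/Claims/NS/Magsanop2026.lean` (typist-9 g5). Refuter of
record: ns-claims-refuter-4 g5 (successor seal 889a3a1f221a5747; lineage seal g4 65fba6ea57d2b706).

VERDICT: first failing step = **Thm 2 «V1 Main Result [2]» p.2 l.30–37** (= §1 p.1 l.35–40), the typed decl
`Literature.Claims.NS.Magsanop2026.Step_Thm2` — the FIRST hypothesis of the typed composition
`claim_of_printed_steps` (it feeds `Step_Rem1 → Step_T0`, the selection of `T₀`) —, class = **false lemma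
(countermodel)**, KILL ROUTE 2 (scaling audit) made into an explicit countermodel (ROUTE 3).

THE DEFECT (dimensional). The display `E(t) ≤ E(0)/(1 + ⅔·ν·C₁·E(0)^{2/3}·t)^{3/2}` is not invariant under
the two-parameter symmetry group of the Navier–Stokes system `u ↦ α·u(β·t, γ·x)`, `p ↦ α²·p`, `ν ↦ α·ν/γ`
(`β = α·γ`; tree `IsClassicalNSSolutionOn.stRescale`). Its one-parameter subgroup `γ = k²`, `α = k³`,
`β = k⁵` FIXES the initial energy `E(0) = ½∫|u₀|²` (`α²·γ⁻³ = 1`) and maps a solution of viscosity `1` to a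
solution of viscosity `k`; reading the display for the image solution at the image `s/k⁵` of a source time
`s > 0` gives `E_u(s) ≤ E(0)/(1 + ⅔·C₁·E(0)^{2/3}·s·k⁻⁴)^{3/2}` for EVERY `k > 0` — whose right side tends to
`0` as `k → 0⁺`. Hence Step_Thm2 forces `E_u(s) ≤ 0` at every `s > 0` for every solution of the class with
the given initial energy: contradicted by any one non-zero smooth solution. This bites the print-faithful
face `C₁ = C₁(E(0))` (Part I §3.3 p.3 l.8–9 «C₁ > 0 depends only on initial energy»; skeleton rev 2) as well
as the universal-`C₁` face (rev 1), because `C₁` does not see `ν`.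

THE KERNEL WITNESS. `U₀ = c₀ • curl(φ e₃)` (the tree's Ramm test datum `testDatum`, smooth, compactly
supported, divergence free, `≠ 0`; `c₀ > 0` Kato's amplitude for `ν = 1`, tree `exists_clayA_smul`): a smooth
bounded-energy solution `(u, p)` of (1)–(3) on `ℝ³ × [0,∞)` with `u(0) = U₀ ≠ 0`, hence (joint continuity at
`t = 0` on a ball) `E_u(σ) > 0` for some `σ > 0`. For `k > 0` the pair
`w_k(s, y) = k³·u(k⁵s, k²y)`, `q_k = k⁶·p(k⁵s, k²y)` is a class solution (`IsSol k T`) from the class datum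
`y ↦ k³·U₀(k²y)` (`IsDatum`: smooth, divergence free, compactly supported ⊂ H¹) with `E(w_k(s)) = E(u(k⁵s))`.

Headline: `not_Step_Thm2 : ¬ Literature.Claims.NS.Magsanop2026.Step_Thm2` (TYPE-EXACT negation of the typed
decl; standard axioms). The family lemma `exists_fixedEnergy_family` is stated so that both the rev-1 face and
the rev-2 face (`C₁ = C₁(E₀)`) die by the same three lines of arithmetic (`not_rate_of_family`).

WHAT THIS IS NOT: not a claim about NS regularity or blow-up; not a claim about any author beyond the
typed locator.
-/

noncomputable section

set_option linter.dupNamespace false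

open MeasureTheory Set Filter Function Metric
open scoped Topology ENNReal ContDiff

namespace Summit.NavierStokesRegularity.NavierStokesRegularity.Theorems.Magsanop2026

open Literature.Analysis.FluidPDE Literature.Claims.NS.Magsanop2026
open Summit.NavierStokesRegularity.NavierStokesRegularity.Theorems.Ramm2024 (testDatum contDiff_testDatum
  hasCompactSupport_testDatum isDivFree_testDatum testDatum_ne_zero)

/-! ## Spatial rescaling of a field: `y ↦ a • v (b • y)` -/

/-- The amplified, spatially rescaled field `y ↦ a • v(b • y)`. [folklore] -/
def scaleField (a b : ℝ) (v : E3 → E3) : E3 → E3 := fun y => a • v (b • y)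

/-- Unfolding `scaleField`. [folklore] -/
@[simp] theorem scaleField_apply (a b : ℝ) (v : E3 → E3) (y : E3) :
    scaleField a b v y = a • v (b • y) := rfl

/-- `y ↦ a • v(b • y)` is smooth if `v` is. [folklore] -/
theorem contDiff_scaleField {v : E3 → E3} (hv : ContDiff ℝ ∞ v) (a b : ℝ) :
    ContDiff ℝ ∞ (scaleField a b v) :=
  (hv.comp (contDiff_id.const_smul b)).const_smul a

/-- `y ↦ a • v(b • y)` is divergence free if `v` is (chain rule and linearity of the trace; tree
`IsDivFree.comp_smul`, `IsDivFree.const_smul`). [folklore] -/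
theorem isDivFree_scaleField {v : E3 → E3} (hv : ContDiff ℝ ∞ v) (hdiv : NSWave0.IsDivFree v) (a b : ℝ) :
    NSWave0.IsDivFree (scaleField a b v) := by
  have h1 : VectorCalculus.IsDivFree (fun y => v (b • y)) :=
    VectorCalculus.IsDivFree.comp_smul (fun x => hdiv x) b
  have hd : Differentiable ℝ (fun y => v (b • y)) :=
    (hv.differentiable (by simp)).comp (differentiable_id.const_smul b)
  exact VectorCalculus.IsDivFree.const_smul hd h1 a

/-- `y ↦ a • v(b • y)` has compact support if `v` has and `b ≠ 0`. [folklore] -/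
theorem hasCompactSupport_scaleField {v : E3 → E3} (hv : HasCompactSupport v) (a : ℝ) {b : ℝ}
    (hb : b ≠ 0) : HasCompactSupport (scaleField a b v) :=
  (hv.comp_smul hb).mono (support_const_smul_subset a fun y => v (b • y))

/-- The rescaled compactly supported smooth divergence-free field is a datum of the typed class
(smooth, divergence free, `H¹` — via Fefferman decay of compactly supported smooth fields). [folklore] -/
theorem isDatum_scaleField {v : E3 → E3} (hv : ContDiff ℝ ∞ v) (hdiv : NSWave0.IsDivFree v)
    (hc : HasCompactSupport v) (a : ℝ) {b : ℝ} (hb : b ≠ 0) : IsDatum (scaleField a b v) :=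
  ⟨contDiff_scaleField hv a b, isDivFree_scaleField hv hdiv a b, fun n _ =>
    (HasRapidSpatialDecay.of_hasCompactSupport (contDiff_scaleField hv a b)
      (hasCompactSupport_scaleField hc a hb)).lintegral_enorm_iteratedFDeriv_sq_lt_top n⟩

/-- **Energy under rescaling**: `E(a • v(b •)) = a² b⁻³ E(v)` for `b > 0` (Mathlib
`Measure.integral_comp_smul_of_nonneg`, `dim ℝ³ = 3`). [folklore] -/
theorem energy_scaleField (a : ℝ) {b : ℝ} (hb : 0 < b) (v : E3 → E3) :
    energy (scaleField a b v) = a ^ 2 * (b ^ 3)⁻¹ * energy v := by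
  simp only [energy, VectorCalculus.kineticEnergy]
  have h1 : (fun y => ‖scaleField a b v y‖ ^ 2) = fun y => a ^ 2 * (fun x => ‖v x‖ ^ 2) (b • y) := by
    funext y
    simp [norm_smul, mul_pow]
  rw [h1, integral_const_mul, Measure.integral_comp_smul_of_nonneg volume (fun x => ‖v x‖ ^ 2) b
    (hR := hb.le), finrank_euclideanSpace_fin, smul_eq_mul]
  ring

/-- **Extended energy under rescaling**: `∫⁻‖a • v(b •)‖ₑ² = ‖a‖ₑ²·|b⁻³|·∫⁻‖v‖ₑ²` (`b ≠ 0`; change of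
variables = the landed `Theorems.Nguyen2022.lintegral_comp_smul`). [folklore] -/
theorem lintegral_enorm_sq_scaleField (a : ℝ) {b : ℝ} (hb : b ≠ 0) (v : E3 → E3) :
    ∫⁻ y, ‖scaleField a b v y‖ₑ ^ 2 = ‖a‖ₑ ^ 2 * ENNReal.ofReal |(b ^ 3)⁻¹| * ∫⁻ x, ‖v x‖ₑ ^ 2 := by
  have h1 : (fun y => ‖scaleField a b v y‖ₑ ^ 2) = fun y => ‖a‖ₑ ^ 2 * (fun x => ‖v x‖ₑ ^ 2) (b • y) := by
    funext y
    rw [scaleField_apply, enorm_smul, mul_pow]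
  rw [h1, lintegral_const_mul' _ _ (ENNReal.pow_ne_top enorm_ne_top),
    Summit.NavierStokesRegularity.NavierStokesRegularity.Theorems.Nguyen2022.lintegral_comp_smul
      (fun x => ‖v x‖ₑ ^ 2) hb, mul_assoc]

/-! ## The fixed-energy symmetry orbit of one Kato solution -/

/-- A continuous square-integrable field that does not vanish at some point has positive energy
(Mathlib `integral_pos_of_integrable_nonneg_nonzero`). [folklore] -/
theorem energy_pos {v : E3 → E3} (hv : Continuous v) (hint : Integrable fun x => ‖v x‖ ^ 2) {x₀ : E3}
    (hx : v x₀ ≠ 0) : 0 < energy v := by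
  have h : 0 < ∫ x, ‖v x‖ ^ 2 :=
    integral_pos_of_integrable_nonneg_nonzero (hv.norm.pow 2) hint (fun x => sq_nonneg _)
      (pow_ne_zero 2 (norm_ne_zero_iff.2 hx))
  simp only [energy, VectorCalculus.kineticEnergy]
  exact mul_pos (by norm_num) h

/-- **The base solution.** Kato's small-data theorem at `ν = 1` (tree `exists_clayA_smul`) applied to the
Ramm test datum gives a smooth bounded-energy solution `(u, p)` of the unforced system on `ℝ³ × [0,∞)`
from `U₀ = c₀ • testDatum ≠ 0`; by joint continuity at `t = 0` at a point where `U₀ ≠ 0` the velocity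
is non-zero there at some time `σ > 0`, so its energy at `σ` is positive. [cite: Kato1984MathZ, Thm. 2 (p. 472)] -/
theorem exists_base :
    ∃ (U₀ : E3 → E3) (u : ℝ → E3 → E3) (p : ℝ → E3 → ℝ) (A : ℝ≥0∞) (σ : ℝ),
      ContDiff ℝ ∞ U₀ ∧ NSWave0.IsDivFree U₀ ∧ HasCompactSupport U₀ ∧
      IsClassicalNSSolutionOn (Ici 0) 1 0 u p ∧ u 0 = U₀ ∧ A < ⊤ ∧
      (∀ t, 0 ≤ t → ∫⁻ x, ‖u t x‖ₑ ^ 2 ≤ A) ∧ 0 < σ ∧ 0 < energy (u σ) := by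
  obtain ⟨c₀, hc₀, hsol⟩ := Literature.Barriers.NavierStokesRegularity.exists_clayA_smul one_pos
    contDiff_testDatum isDivFree_testDatum
    (HasRapidSpatialDecay.of_hasCompactSupport contDiff_testDatum hasCompactSupport_testDatum)
  obtain ⟨u, p, hu, hp, hns, A, hA, hAb⟩ := hsol c₀ (by rw [abs_of_pos hc₀])
  have hcl : IsClassicalNSSolutionOn (Ici 0) 1 0 u p :=
    (isNavierStokesSolution_and_smooth_iff.1 ⟨hns, hu, hp⟩).1
  have h0 : u 0 = c₀ • testDatum := hns.initial
  -- a point where the datum does not vanish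
  obtain ⟨x₀, hx₀⟩ : ∃ x₀, (c₀ • testDatum) x₀ ≠ 0 :=
    Function.ne_iff.1 (smul_ne_zero hc₀.ne' testDatum_ne_zero)
  have hm0 : 0 < ‖u 0 x₀‖ := by
    rw [h0]
    exact norm_pos_iff.2 hx₀
  -- joint continuity of `u` at `(0, x₀)` within the closed half-space
  have hcont : ContinuousWithinAt (uncurry u) (Ici (0 : ℝ) ×ˢ univ) (0, x₀) :=
    hu.continuousOn.continuousWithinAt (mk_mem_prod (mem_Ici.2 le_rfl) (mem_univ _))
  obtain ⟨δ, hδ, hδu⟩ := Metric.continuousWithinAt_iff.1 hcont ‖u 0 x₀‖ hm0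
  have hσ0 : (0 : ℝ) < δ / 2 := by positivity
  have hmem : ((δ / 2, x₀) : ℝ × E3) ∈ Ici (0 : ℝ) ×ˢ (univ : Set E3) :=
    mk_mem_prod (mem_Ici.2 hσ0.le) (mem_univ _)
  have hdist : dist ((δ / 2, x₀) : ℝ × E3) (0, x₀) < δ := by
    rw [Prod.dist_eq, dist_self, Real.dist_eq, sub_zero, abs_of_pos hσ0, max_lt_iff]
    exact ⟨by linarith, hδ⟩
  have key := hδu hmem hdist
  rw [uncurry_apply_pair, uncurry_apply_pair, dist_eq_norm] at key
  -- `‖u (δ/2) x₀ - u 0 x₀‖ < ‖u 0 x₀‖` forbids `u (δ/2) x₀ = 0`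
  have hne : u (δ / 2) x₀ ≠ 0 := by
    intro hz
    rw [hz, zero_sub, norm_neg] at key
    exact lt_irrefl _ key
  have hcσ : Continuous (u (δ / 2)) := (hcl.contDiff_velocity (mem_Ici.2 hσ0.le)).continuous
  have hint : Integrable fun y => ‖u (δ / 2) y‖ ^ 2 :=
    integrable_sq_of_lintegral_enorm_sq_lt_top hcσ ((hAb _ hσ0.le).trans_lt hA)
  exact ⟨c₀ • testDatum, u, p, A, δ / 2, contDiff_testDatum.const_smul c₀,
    VectorCalculus.IsDivFree.const_smul (contDiff_testDatum.differentiable (by simp))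
      isDivFree_testDatum c₀,
    hasCompactSupport_testDatum.mono (support_const_smul_subset c₀ testDatum), hcl, h0, hA, hAb, hσ0,
    energy_pos hcσ hint hne⟩

/-- **The rescaled solution is a solution of the typed class.** For a classical solution `(u, p)` of
the unforced system with viscosity `1` on `[0,∞)` with `u 0 = U₀` and energy `≤ A < ∞`, and `k > 0`, the
pair `w(s, y) = k³ u(k⁵ s, k² y)`, `q = k⁶ p(k⁵ s, k² y)` is a class solution (`IsSol k T`) from
`y ↦ k³ U₀(k² y)` on every `[0,T)` (tree `IsClassicalNSSolutionOn.stRescale`, viscosity `k³·1/k² = k`).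
[cite: Leray1934, §20] -/
theorem isSol_rescale {U₀ : E3 → E3} {u : ℝ → E3 → E3} {p : ℝ → E3 → ℝ} {A : ℝ≥0∞}
    (hcl : IsClassicalNSSolutionOn (Ici 0) 1 0 u p) (h0 : u 0 = U₀) (hA : A < ⊤)
    (hAb : ∀ t, 0 ≤ t → ∫⁻ x, ‖u t x‖ₑ ^ 2 ≤ A) {k : ℝ} (hk : 0 < k) (T : ℝ) :
    IsSol k T (scaleField (k ^ 3) (k ^ 2) U₀) (k ^ 3 • stPull (k ^ 5) (k ^ 2) 0 0 u)
      ((k ^ 3) ^ 2 • stPull (k ^ 5) (k ^ 2) 0 0 p) where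
  classical := by
    have key := hcl.stRescale (α := k ^ 3) (β := k ^ 5) (γ := k ^ 2) (by positivity) (by positivity)
      (by ring) 0 0
    rw [smul_stPull_zero, show (k ^ 3 * 1 / k ^ 2 : ℝ) = k by field_simp] at key
    refine key.mono (fun r hr => ?_) (uniqueDiffOn_Ico 0 T)
    simp only [mem_preimage, mem_Ici]
    have := hr.1
    positivity
  initial := by
    funext y
    simp [stPull_apply, h0]
  energy := by
    refine ⟨‖(k ^ 3 : ℝ)‖ₑ ^ 2 * ENNReal.ofReal |((k ^ 2) ^ 3)⁻¹| * A,
      ENNReal.mul_lt_top (ENNReal.mul_lt_top (ENNReal.pow_lt_top enorm_lt_top) ENNReal.ofReal_lt_top) hA,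
      fun t ht => ?_⟩
    have hkt : 0 ≤ k ^ 5 * t := mul_nonneg (by positivity) ht.1
    have heq : (fun y => ‖(k ^ 3 • stPull (k ^ 5) (k ^ 2) 0 0 u) t y‖ₑ ^ 2) =
        fun y => ‖scaleField (k ^ 3) (k ^ 2) (u (k ^ 5 * t)) y‖ₑ ^ 2 := by
      funext y
      simp [stPull_apply]
    rw [heq, lintegral_enorm_sq_scaleField _ (by positivity)]
    gcongr
    exact hAb _ hkt

/-- **Energy along the rescaled solution**: `E(w(s)) = E(u(k⁵ s))` (`α²γ⁻³ = k⁶k⁻⁶ = 1`). [folklore] -/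
theorem energy_rescale (u : ℝ → E3 → E3) {k : ℝ} (hk : 0 < k) (s : ℝ) :
    energy ((k ^ 3 • stPull (k ^ 5) (k ^ 2) 0 0 u) s) = energy (u (k ^ 5 * s)) := by
  have heq : (k ^ 3 • stPull (k ^ 5) (k ^ 2) 0 0 u) s = scaleField (k ^ 3) (k ^ 2) (u (k ^ 5 * s)) := by
    funext y
    simp [stPull_apply]
  rw [heq, energy_scaleField _ (by positivity)]
  field_simp

/-- **The fixed-energy family.** There are `E₀ ≥ 0`, a source time `σ > 0` and a level `e > 0` such
that for EVERY viscosity `k > 0` the typed class contains a datum of energy `E₀` and a class solution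
from it on `[0, σ/k⁵ + 1)` whose energy at time `σ/k⁵` equals `e`. [cite: Leray1934, §20] [cite: Kato1984MathZ, Thm. 2 (p. 472)] -/
theorem exists_fixedEnergy_family :
    ∃ (E₀ σ e : ℝ), 0 < σ ∧ 0 < e ∧ ∀ k : ℝ, 0 < k →
      ∃ (u₀ : E3 → E3) (T : ℝ) (u : ℝ → E3 → E3) (p : ℝ → E3 → ℝ),
        IsDatum u₀ ∧ energy u₀ = E₀ ∧ IsSol k T u₀ u p ∧ σ / k ^ 5 ∈ Ico 0 T ∧
          energy (u (σ / k ^ 5)) = e := by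
  obtain ⟨U₀, u, p, A, σ, hsm, hdiv, hcs, hcl, h0, hA, hAb, hσ, he⟩ := exists_base
  refine ⟨energy U₀, σ, energy (u σ), hσ, he, fun k hk => ?_⟩
  refine ⟨scaleField (k ^ 3) (k ^ 2) U₀, σ / k ^ 5 + 1, k ^ 3 • stPull (k ^ 5) (k ^ 2) 0 0 u,
    (k ^ 3) ^ 2 • stPull (k ^ 5) (k ^ 2) 0 0 p, isDatum_scaleField hsm hdiv hcs _ (by positivity), ?_,
    isSol_rescale hcl h0 hA hAb hk _, ⟨by positivity, by linarith⟩, ?_⟩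
  · rw [energy_scaleField _ (by positivity)]
    field_simp
  · rw [energy_rescale u hk, mul_div_cancel₀ _ (by positivity)]

/-! ## The arithmetic: no rate of the printed shape survives the family -/

/-- **No constant works at fixed energy.** If for some `C₁ > 0` the printed rate held for every viscosity
`k > 0` along the fixed-energy family (energy `E₀`, source time `σ`, level `e > 0`), i.e.
`e ≤ E₀/(1 + ⅔·k·C₁·E₀^{2/3}·(σ/k⁵))^{3/2}` for all `k > 0`, contradiction: for `E₀ = 0` the right side
is `0`; for `E₀ > 0` it is `≤ E₀·k⁴/D` with `D = ⅔·C₁·E₀^{2/3}·σ > 0`, smaller than `e` for small `k`. [folklore] -/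
theorem not_rate_of_family {E₀ σ e C₁ : ℝ} (hσ : 0 < σ) (he : 0 < e) (hC₁ : 0 < C₁) (hE₀ : 0 ≤ E₀)
    (h : ∀ k : ℝ, 0 < k →
      e ≤ E₀ / (1 + 2 / 3 * k * C₁ * E₀ ^ (2 / 3 : ℝ) * (σ / k ^ 5)) ^ (3 / 2 : ℝ)) : False := by
  rcases hE₀.eq_or_lt with hE | hE
  · -- `E₀ = 0`: the right side vanishes
    have := h 1 one_pos
    rw [← hE, zero_div] at this
    linarith
  · set D : ℝ := 2 / 3 * C₁ * E₀ ^ (2 / 3 : ℝ) * σ with hD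
    have hD0 : 0 < D := by
      have : 0 < E₀ ^ (2 / 3 : ℝ) := Real.rpow_pos_of_pos hE _
      positivity
    -- choose `k ≤ 1` with `k ≤ D e / (2 E₀)`
    set k : ℝ := min 1 (D * e / (2 * E₀)) with hk
    have hk0 : 0 < k := lt_min one_pos (by positivity)
    have hk1 : k ≤ 1 := min_le_left _ _
    have hk2 : k ≤ D * e / (2 * E₀) := min_le_right _ _
    have key := h k hk0
    -- the base of the power is `1 + D / k⁴ ≥ 1`
    have hbase : 1 + 2 / 3 * k * C₁ * E₀ ^ (2 / 3 : ℝ) * (σ / k ^ 5) = 1 + D / k ^ 4 := by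
      rw [hD]
      field_simp
    rw [hbase] at key
    have hb1 : 1 ≤ 1 + D / k ^ 4 := le_add_of_nonneg_right (by positivity)
    have hb0 : 0 < 1 + D / k ^ 4 := by positivity
    -- `(1 + D/k⁴)^{3/2} ≥ 1 + D/k⁴ > D/k⁴`
    have hpow : 1 + D / k ^ 4 ≤ (1 + D / k ^ 4) ^ (3 / 2 : ℝ) := by
      have := Real.rpow_le_rpow_of_exponent_le hb1 (show (1 : ℝ) ≤ 3 / 2 by norm_num)
      rwa [Real.rpow_one] at this
    have h1 : E₀ / (1 + D / k ^ 4) ^ (3 / 2 : ℝ) ≤ E₀ / (1 + D / k ^ 4) :=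
      div_le_div_of_nonneg_left hE.le hb0 hpow
    have h2 : E₀ / (1 + D / k ^ 4) ≤ E₀ / (D / k ^ 4) :=
      div_le_div_of_nonneg_left hE.le (by positivity) (by linarith)
    have h3 : E₀ / (D / k ^ 4) = E₀ * k ^ 4 / D := by
      field_simp
    have hk4 : k ^ 4 ≤ k := by
      have : k ^ 4 ≤ k ^ 1 := pow_le_pow_of_le_one hk0.le hk1 (by norm_num)
      rwa [pow_one] at this
    have h4 : E₀ * k ^ 4 / D ≤ E₀ * k / D :=
      div_le_div_of_nonneg_right (mul_le_mul_of_nonneg_left hk4 hE.le) hD0.le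
    have h5 : E₀ * k / D ≤ E₀ * (D * e / (2 * E₀)) / D :=
      div_le_div_of_nonneg_right (mul_le_mul_of_nonneg_left hk2 hE.le) hD0.le
    have h6 : E₀ * (D * e / (2 * E₀)) / D = e / 2 := by
      field_simp
    linarith

/-! ## The refutation -/

/-- **C145 KILL — Theorem 2 «V1 Main Result» p.2 l.30–37 is false as typed** (`¬ Step_Thm2`,
TYPE-EXACT). The fixed-energy symmetry orbit `w_k(s,y) = k³u(k⁵s, k²y)` (viscosity `k`, the same initial
energy `E₀` for all `k`) of one non-zero Kato solution carries the positive energy level `e = E_u(σ)` at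
the times `σ/k⁵`; the printed rate with any `C₁ = C₁(E₀) > 0` would force `e ≤ E₀/(1 + D·k⁻⁴)^{3/2} → 0`
(`k → 0⁺`). Class: false lemma (countermodel) — dimensional inconsistency of «ν·C₁·E^{2/3}·t» (KILL ROUTE
2 → 3). [cite: Magsanop2026, Thm 2 p.2 l.30–37; §1 p.1 l.35–40] [cite: Leray1934, §20] [cite: Kato1984MathZ, Thm. 2 (p. 472)] -/
theorem not_Step_Thm2 : ¬ Step_Thm2 := by
  intro h
  obtain ⟨E₀, σ, e, hσ, he, fam⟩ := exists_fixedEnergy_family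
  -- E₀ ≥ 0 (energy of a datum)
  obtain ⟨u₁, T₁, v₁, p₁, hd₁, hE₁, -, -, -⟩ := fam 1 one_pos
  have hE₀ : 0 ≤ E₀ := hE₁ ▸ kineticEnergy_nonneg _
  obtain ⟨C₁, hC₁, hC⟩ := h E₀
  refine not_rate_of_family hσ he hC₁ hE₀ fun k hk => ?_
  obtain ⟨u₀, T, u, p, hd, hEu, hsol, hmem, heq⟩ := fam k hk
  have key := hC k hk u₀ hd hEu T u p hsol (σ / k ^ 5) hmem
  rwa [heq] at key

/-- info: 'Summit.NavierStokesRegularity.NavierStokesRegularity.Theorems.Magsanop2026.not_Step_Thm2' depends on axioms: [propext, Classical.choice, Quot.sound] -/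
#guard_msgs (whitespace := lax) in
#print axioms not_Step_Thm2

end Summit.NavierStokesRegularity.NavierStokesRegularity.Theorems.Magsanop2026

end

-- WHAT THIS IS NOT: not a claim about NS regularity or blow-up; not a claim about any author beyond the
-- typed locator.
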